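import Summits.QuantumFields.YangMills.Theorems.SqueezedSkewnessFemtoCeiling
import Summits.QuantumFields.YangMills.Theorems.BalabanLadderNTCeilingPrice
import Summits.QuantumFields.YangMills.Theorems.UniversalDetectorLatticeRiemannBounds
import HarnessLib

/-!
# Crux `BalabanLadder.NT` (stmt-QuantumFields-19353), LINE μ «slab response» (planner ym-idea-6 g13), support stub
# `stub_mirrorDescent`, plan steps 4–5: `Q2`-bookkeeping — bilinearity, Riemann sums of decaying weights, and the
# smeared two-point CEILING from the `n = 2` collar output for slab-separated pairs

Elementary lemmas in the `torusE` / `Q2` vocabulary of `DlrCollarTransfer` (no `Fin`-torus dictionary needed), for the floor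
transfer `v ↦ u = v(· + τe₀)` (`|Q2(θu, u) − Q2(θv, v)| ≤ |Q2(θ(u − v), u)| + |Q2(θv, u − v)|`, each term = (Riemann sum
of a weight) × (Riemann sum of a weight) × (pair bound)) and for the ceiling of `Q2(θg, g)`:

* `Q2_sub_left`, `Q2_sub_right`, `Q2_sub_Q2` — bilinearity of `Q2` (finite sums);
* `sum_box_abs_le_of_decay` — `Σ_{x ∈ box L} |φ(s·x)| ≤ M·4⁴/s⁴` for `|φ(y)| ≤ M(1 + ‖y‖)⁻⁸`, `0 < s ≤ 1`
  (`latticeRiemannBound`); corollaries for a Schwartz weight, its time reflection, and a shifted difference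
  `v(· + e) − v` (`‖e‖ ≤ 1`, one factor `‖e‖` gained: `exists_abs_sub_le_decay`);
* `abs_cov_dens_le` — `|Cov_T(dens X, dens Y)| ≤ 36 (C/R⁴)²` for sites `2R + 4` apart in time (cyclically), from the `n = 2`
  case of the plane-resolved collar output (`FemtoCeilingProof.abs_cov_plane_le`, `cov_dens_eq_sum_cov_plane_univ`);
* `sep_of_charged_slabs` — sites charged by `θf` and by `g`, `f, g` supported in the slab `{h ≤ y₀ ≤ H}` (`2H ≤ sL`,
  `(2R+4)s ≤ 2h`), are `≥ 2R + 4` apart;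
* `abs_Q2_theta_le` — the smeared ceiling `|Q2 G r β L s (θf) g| ≤ S_{θf} · S_g · 36 (C/R⁴)²`.

THEOREMS ONLY; Mathlib + tree; no `sorry`; standard axioms.  HONEST FRAMING: helper lemmas toward a line's support stub; no NT
statement, node, rung or summit is proved; the Yang–Mills mass gap is NOT proved.  Width seat `ym-line-sfw-p2-w4` g19 (cell ym-idea-1,
free hands). [folklore]
-/

set_option autoImplicit false

noncomputable section

open scoped SchwartzMap
open MeasureTheory Literature.MathematicalPhysics.QuantumFieldTheory Literature.MathematicalPhysics.QuantumLattice
open Literature.Probability.LatticeModels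
open Summit.QuantumFields.YangMills.Cruxes.OSLegsFromFemtoAndGap.DlrCollarTransfer

namespace Summit.QuantumFields.YangMills.Theorems.MirrorDescentQ2

variable (G : Type) [Group G] [TopologicalSpace G] [IsTopologicalGroup G] [CompactSpace G]
  [MeasurableSpace G] [BorelSpace G] (r : LatticeRep G)

/-! ## §1 Bilinearity of `Q2` -/

/-- `Q2(f − f', g) = Q2(f, g) − Q2(f', g)`. [folklore] -/
theorem Q2_sub_left (β : ℝ) (L : ℕ) (s : ℝ) (f f' g : 𝓢(EuclideanSpace ℝ (Fin 4), ℝ)) :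
    Q2 G r β L s (f - f') g = Q2 G r β L s f g - Q2 G r β L s f' g := by
  unfold Q2
  rw [← Finset.sum_sub_distrib]
  refine Finset.sum_congr rfl fun x _ => ?_
  rw [← Finset.sum_sub_distrib]
  refine Finset.sum_congr rfl fun y _ => ?_
  rw [sub_apply]
  ring

/-- `Q2(f, g − g') = Q2(f, g) − Q2(f, g')`. [folklore] -/
theorem Q2_sub_right (β : ℝ) (L : ℕ) (s : ℝ) (f g g' : 𝓢(EuclideanSpace ℝ (Fin 4), ℝ)) :
    Q2 G r β L s f (g - g') = Q2 G r β L s f g - Q2 G r β L s f g' := by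
  unfold Q2
  rw [← Finset.sum_sub_distrib]
  refine Finset.sum_congr rfl fun x _ => ?_
  rw [← Finset.sum_sub_distrib]
  refine Finset.sum_congr rfl fun y _ => ?_
  rw [sub_apply]
  ring

/-- **Floor-transfer identity**: `Q2(f, g) − Q2(f', g') = Q2(f − f', g) + Q2(f', g − g')`. [folklore] -/
theorem Q2_sub_Q2 (β : ℝ) (L : ℕ) (s : ℝ) (f f' g g' : 𝓢(EuclideanSpace ℝ (Fin 4), ℝ)) :
    Q2 G r β L s f g - Q2 G r β L s f' g' = Q2 G r β L s (f - f') g + Q2 G r β L s f' (g - g') := by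
  rw [Q2_sub_left, Q2_sub_right]
  ring

/-- `θ(f − f') = θf − θf'`. [folklore] -/
theorem thetaTest_sub (f f' : 𝓢(EuclideanSpace ℝ (Fin 4), ℝ)) :
    thetaTest 4 (f - f') = thetaTest 4 f - thetaTest 4 f' :=
  map_sub (thetaTest 4) f f'

/-! ## §2 Riemann sums of decaying weights over the box -/

/-- **Uniform lattice Riemann bound for a decaying weight**: `Σ_{x ∈ box L} |φ(s·x)| ≤ M·4⁴/s⁴` whenever
`|φ(y)| ≤ M(1 + ‖y‖)⁻⁸` and `0 < s ≤ 1`. [folklore] -/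
theorem sum_box_abs_le_of_decay {φ : EuclideanSpace ℝ (Fin 4) → ℝ} {M : ℝ} (hM : 0 ≤ M)
    (hφ : ∀ y, |φ y| ≤ M * ((1 + ‖y‖) ^ 8)⁻¹) {s : ℝ} (hs : 0 < s) (hs1 : s ≤ 1) (L : ℕ) :
    ∑ x ∈ box 4 L, |φ (s • siteToE x)| ≤ M * 4 ^ 4 / s ^ 4 := by
  have hRB := Summit.QuantumFields.YangMills.Cruxes.UniversalDetectorLimitExtraction.latticeRiemannBound 4 L hs hs1
  have hs4 : 0 < s ^ 4 := by positivity
  have hsum : ∑ x ∈ box 4 L, ((1 + ‖s • siteToE x‖) ^ (2 * 4))⁻¹ ≤ 4 ^ 4 / s ^ 4 := by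
    rw [le_div_iff₀ hs4, mul_comm]; exact hRB
  calc ∑ x ∈ box 4 L, |φ (s • siteToE x)|
      ≤ ∑ x ∈ box 4 L, M * ((1 + ‖s • siteToE x‖) ^ (2 * 4))⁻¹ := Finset.sum_le_sum fun x _ => hφ _
    _ = M * ∑ x ∈ box 4 L, ((1 + ‖s • siteToE x‖) ^ (2 * 4))⁻¹ := by rw [Finset.mul_sum]
    _ ≤ M * (4 ^ 4 / s ^ 4) := mul_le_mul_of_nonneg_left hsum hM
    _ = M * 4 ^ 4 / s ^ 4 := by ring

/-- The time reflection preserves the decay weight. [folklore] -/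
theorem decay_timeReflection (y : EuclideanSpace ℝ (Fin 4)) :
    ((1 + ‖timeReflection 4 y‖) ^ 8)⁻¹ = ((1 + ‖y‖) ^ 8)⁻¹ := by
  rw [LinearIsometryEquiv.norm_map]

/-- **Riemann bound for a reflected decaying weight**: `Σ_{x ∈ box L} |φ(θ(s·x))| ≤ M·4⁴/s⁴`. [folklore] -/
theorem sum_box_abs_theta_le_of_decay {φ : EuclideanSpace ℝ (Fin 4) → ℝ} {M : ℝ} (hM : 0 ≤ M)
    (hφ : ∀ y, |φ y| ≤ M * ((1 + ‖y‖) ^ 8)⁻¹) {s : ℝ} (hs : 0 < s) (hs1 : s ≤ 1) (L : ℕ) :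
    ∑ x ∈ box 4 L, |φ (timeReflection 4 (s • siteToE x))| ≤ M * 4 ^ 4 / s ^ 4 :=
  sum_box_abs_le_of_decay (φ := fun y => φ (timeReflection 4 y)) hM
    (fun y => (hφ _).trans_eq (by rw [decay_timeReflection])) hs hs1 L

/-- **Riemann bound for a Schwartz weight and its time reflection**: with `K_v` from `exists_abs_le_decay`,
`Σ_{x ∈ box L} |v(s·x)| ≤ K_v·4⁴/s⁴` and `Σ_{x ∈ box L} |(θv)(s·x)| ≤ K_v·4⁴/s⁴`. [folklore] -/
theorem sum_box_abs_schwartz_le (v : 𝓢(EuclideanSpace ℝ (Fin 4), ℝ)) {K : ℝ} (hK0 : 0 ≤ K)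
    (hK : ∀ y : EuclideanSpace ℝ (Fin 4), |v y| ≤ K * ((1 + ‖y‖) ^ 8)⁻¹) {s : ℝ} (hs : 0 < s) (hs1 : s ≤ 1) (L : ℕ) :
    ∑ x ∈ box 4 L, |v (s • siteToE x)| ≤ K * 4 ^ 4 / s ^ 4 ∧
      ∑ x ∈ box 4 L, |thetaTest 4 v (s • siteToE x)| ≤ K * 4 ^ 4 / s ^ 4 := by
  refine ⟨sum_box_abs_le_of_decay hK0 hK hs hs1 L, ?_⟩
  simp only [thetaTest_apply]
  exact sum_box_abs_theta_le_of_decay hK0 hK hs hs1 L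

/-- **Riemann bound for a shifted difference** (one factor `‖e‖` gained): with `K` from `exists_abs_sub_le_decay`, for
`‖e‖ ≤ 1`, `Σ_{x ∈ box L} |v(s·x + e) − v(s·x)| ≤ K‖e‖·4⁴/s⁴`, and the same for the reflected sample points.
[folklore] -/
theorem sum_box_abs_shift_sub_le (v : 𝓢(EuclideanSpace ℝ (Fin 4), ℝ)) {K : ℝ} (hK0 : 0 ≤ K)
    (hK : ∀ (z e : EuclideanSpace ℝ (Fin 4)), ‖e‖ ≤ 1 → |v (z + e) - v z| ≤ K * ‖e‖ * ((1 + ‖z‖) ^ 8)⁻¹)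
    (e : EuclideanSpace ℝ (Fin 4)) (he : ‖e‖ ≤ 1) {s : ℝ} (hs : 0 < s) (hs1 : s ≤ 1) (L : ℕ) :
    ∑ x ∈ box 4 L, |v (s • siteToE x + e) - v (s • siteToE x)| ≤ K * ‖e‖ * 4 ^ 4 / s ^ 4 ∧
      ∑ x ∈ box 4 L, |v (timeReflection 4 (s • siteToE x) + e) - v (timeReflection 4 (s • siteToE x))| ≤
        K * ‖e‖ * 4 ^ 4 / s ^ 4 := by
  have hφ : ∀ y : EuclideanSpace ℝ (Fin 4), |v (y + e) - v y| ≤ K * ‖e‖ * ((1 + ‖y‖) ^ 8)⁻¹ := fun y => hK y e he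
  have hM : 0 ≤ K * ‖e‖ := mul_nonneg hK0 (norm_nonneg _)
  exact ⟨sum_box_abs_le_of_decay (φ := fun y => v (y + e) - v y) hM hφ hs hs1 L,
    sum_box_abs_theta_le_of_decay (φ := fun y => v (y + e) - v y) hM hφ hs hs1 L⟩

/-! ## §3 The pair bound for action densities from the `n = 2` collar output -/

/-- **Two action densities separated in time have small torus covariance**: `|Cov_T(dens X, dens Y)| ≤ 36 (C/R⁴)²` once the
times of `X`, `Y` are `≥ 2R + 4` apart cyclically, from the `n = 2` case of the plane-resolved collar output at one coupling
(`6 × 6` plane pairs). [folklore] -/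
theorem abs_cov_dens_le (β : ℝ) (L : ℕ) {C : ℝ} {R : ℕ}
    (H : ∀ (n : ℕ) (q : Fin n → Fin 4 × Fin 4) (x : Fin n → (Fin 4 → ℤ)), (∀ i, (q i).1 < (q i).2) →
      (∀ i j : Fin n, i ≠ j → ∃ k : Fin 4,
        (2 * (R : ℤ) + 4) ≤ |((((x i k - x j k : ℤ) : ZMod (2 * L + 1))).valMinAbs : ℤ)|) →
      |torusE G r β L (fun U => ∏ i, (plane G r (q i) (x i) U - torusE G r β L (plane G r (q i) (x i))))| ≤
        (C / (R : ℝ) ^ 4) ^ n)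
    (X Y : Fin 4 → ℤ) (hsep : (2 * (R : ℤ) + 4) ≤ |((((X 0 - Y 0 : ℤ) : ZMod (2 * L + 1))).valMinAbs : ℤ)|) :
    |torusE G r β L (fun V => dens G r X V * dens G r Y V) - torusE G r β L (dens G r X) * torusE G r β L (dens G r Y)| ≤
      36 * (C / (R : ℝ) ^ 4) ^ 2 := by
  rw [Summit.QuantumFields.YangMills.Cruxes.UniversalDetectorPlaneTight.cov_dens_eq_sum_cov_plane_univ r β L X Y]
  refine (Finset.abs_sum_le_sum_abs _ _).trans ?_
  have h1 : ∀ p ∈ (Finset.univ : Finset {q : Fin 4 × Fin 4 // q.1 < q.2}),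
      |∑ q : {q : Fin 4 × Fin 4 // q.1 < q.2},
        (torusE G r β L (fun V => plane G r p.1 X V * plane G r q.1 Y V) -
          torusE G r β L (plane G r p.1 X) * torusE G r β L (plane G r q.1 Y))| ≤ 6 * (C / (R : ℝ) ^ 4) ^ 2 := by
    intro p _
    refine (Finset.abs_sum_le_sum_abs _ _).trans ?_
    have h2 : ∀ q ∈ (Finset.univ : Finset {q : Fin 4 × Fin 4 // q.1 < q.2}),
        |torusE G r β L (fun V => plane G r p.1 X V * plane G r q.1 Y V) -
          torusE G r β L (plane G r p.1 X) * torusE G r β L (plane G r q.1 Y)| ≤ (C / (R : ℝ) ^ 4) ^ 2 :=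
      fun q _ => Summit.QuantumFields.YangMills.Theorems.FemtoCeilingProof.abs_cov_plane_le G r β L H p q X Y hsep
    refine (Finset.sum_le_sum h2).trans ?_
    rw [Finset.sum_const, Finset.card_univ, show Fintype.card {q : Fin 4 × Fin 4 // q.1 < q.2} = 6 by decide,
      nsmul_eq_mul]
    norm_num
  refine (Finset.sum_le_sum h1).trans ?_
  rw [Finset.sum_const, Finset.card_univ, show Fintype.card {q : Fin 4 × Fin 4 // q.1 < q.2} = 6 by decide,
    nsmul_eq_mul]
  norm_num
  exact le_of_eq (by ring)

/-! ## §4 Separation of the charged pairs of two slab weights -/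

/-- The time coordinate of a sample point. [folklore] -/
theorem smul_siteToE_zero (s : ℝ) (x : Fin 4 → ℤ) : (s • siteToE (d := 4) x) 0 = s * (x 0 : ℝ) := by
  simp [siteToE_apply]

/-- **Separation of charged mirror pairs.**  If `f` and `g` are supported in the slab `{h ≤ y₀ ≤ H}` with `2H ≤ sL` and
`(2R + 4)s ≤ 2h`, then a site `x` charged by `θf` (i.e. `f(θ(s·x)) ≠ 0`) and a site `y` charged by `g` are `≥ 2R + 4` apart in
time, cyclically on the odd torus `2L+1`. [folklore] -/
theorem sep_of_charged_slabs {f g : EuclideanSpace ℝ (Fin 4) → ℝ} {s h H : ℝ} {L R : ℕ} (hs : 0 < s)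
    (hf : tsupport f ⊆ {y : EuclideanSpace ℝ (Fin 4) | h ≤ y 0 ∧ y 0 ≤ H})
    (hg : tsupport g ⊆ {y : EuclideanSpace ℝ (Fin 4) | h ≤ y 0 ∧ y 0 ≤ H})
    (hHL : 2 * H ≤ s * L) (hR : (2 * R + 4) * s ≤ 2 * h) (x y : Fin 4 → ℤ)
    (hx : f (timeReflection 4 (s • siteToE (d := 4) x)) ≠ 0) (hy : g (s • siteToE (d := 4) y) ≠ 0) :
    (2 * (R : ℤ) + 4) ≤ |((((x 0 - y 0 : ℤ) : ZMod (2 * L + 1))).valMinAbs : ℤ)| := by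
  have hx' := hf (subset_tsupport _ (Function.mem_support.2 hx))
  have hy' := hg (subset_tsupport _ (Function.mem_support.2 hy))
  simp only [Set.mem_setOf_eq, timeReflection_apply, if_true, smul_siteToE_zero] at hx' hy'
  -- `m = y₀ − x₀` satisfies `(2R + 4) ≤ m ≤ L`
  have hm1 : (2 * R + 4 : ℝ) * s ≤ s * ((y 0 : ℝ) - x 0) := by linarith [hx'.1, hy'.1]
  have hm2 : s * ((y 0 : ℝ) - x 0) ≤ s * L := by linarith [hx'.2, hy'.2]
  have hm1' : (2 * R + 4 : ℝ) ≤ (y 0 : ℝ) - x 0 := le_of_mul_le_mul_right (by linarith [hm1]) hs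
  have hm2' : (y 0 : ℝ) - x 0 ≤ L := le_of_mul_le_mul_left hm2 hs
  have hmZ1 : (2 * (R : ℤ) + 4) ≤ y 0 - x 0 := by exact_mod_cast hm1'
  have hmZ2 : y 0 - x 0 ≤ (L : ℤ) := by exact_mod_cast hm2'
  have hval : ((((x 0 - y 0 : ℤ)) : ZMod (2 * L + 1))).valMinAbs = x 0 - y 0 := by
    rw [ZMod.valMinAbs_spec]
    refine ⟨rfl, ?_, ?_⟩
    · push_cast; omega
    · push_cast; omega
  rw [hval, show (x 0 - y 0 : ℤ) = -(y 0 - x 0) by ring, abs_neg, abs_of_nonneg (by omega)]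
  exact hmZ1

/-! ## §5 The smeared two-point ceiling for slab-separated weights -/

/-- **Smeared ceiling from the `n = 2` collar output.**  For Schwartz `f, g` supported in the slab `{h ≤ y₀ ≤ H}`
(`2H ≤ sL`, `(2R + 4)s ≤ 2h`) and the collar output at coupling `β`, radius `R` on the torus `2L+1`:
`|Q2 G r β L s (θf) g| ≤ (Σ_x |(θf)(s·x)|) · (Σ_y |g(s·y)|) · 36 (C/R⁴)²`. [folklore] -/
theorem abs_Q2_theta_le (β : ℝ) (L : ℕ) {s : ℝ} (hs : 0 < s) (f g : 𝓢(EuclideanSpace ℝ (Fin 4), ℝ)) {C h H : ℝ} {R : ℕ}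
    (H6 : ∀ (n : ℕ) (q : Fin n → Fin 4 × Fin 4) (x : Fin n → (Fin 4 → ℤ)), (∀ i, (q i).1 < (q i).2) →
      (∀ i j : Fin n, i ≠ j → ∃ k : Fin 4,
        (2 * (R : ℤ) + 4) ≤ |((((x i k - x j k : ℤ) : ZMod (2 * L + 1))).valMinAbs : ℤ)|) →
      |torusE G r β L (fun U => ∏ i, (plane G r (q i) (x i) U - torusE G r β L (plane G r (q i) (x i))))| ≤
        (C / (R : ℝ) ^ 4) ^ n)
    (hf : tsupport (f : EuclideanSpace ℝ (Fin 4) → ℝ) ⊆ {y : EuclideanSpace ℝ (Fin 4) | h ≤ y 0 ∧ y 0 ≤ H})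
    (hg : tsupport (g : EuclideanSpace ℝ (Fin 4) → ℝ) ⊆ {y : EuclideanSpace ℝ (Fin 4) | h ≤ y 0 ∧ y 0 ≤ H})
    (hHL : 2 * H ≤ s * L) (hR : (2 * R + 4) * s ≤ 2 * h) :
    |Q2 G r β L s (thetaTest 4 f) g| ≤
      (∑ x ∈ box 4 L, |thetaTest 4 f (s • siteToE x)|) * (∑ y ∈ box 4 L, |g (s • siteToE y)|) *
        (36 * (C / (R : ℝ) ^ 4) ^ 2) := by
  refine Summit.QuantumFields.YangMills.Cruxes.NT.CeilingPrice.abs_Q2_le_of_pointwise G r β L s (thetaTest 4 f) g ?_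
  intro x _ y _ hx hy
  rw [thetaTest_apply] at hx
  exact abs_cov_dens_le G r β L H6 x y (sep_of_charged_slabs hs hf hg hHL hR x y hx hy)

end Summit.QuantumFields.YangMills.Theorems.MirrorDescentQ2

end
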